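import Summits.HodgeConjecture.HodgeConjecture.Theorems.Ring2WeilCoverageCMFieldAllPrimesV
import Summits.HodgeConjecture.HodgeConjecture.Theorems.Ring2WeilCoverageCMFieldAllPrimesM
import HarnessLib

/-!
# Weil-type components over quartic CM fields, IX (part W): the INTEGER classes `[n]` of the seventh census
# table, `E = ℚ(√-(3+√2))` — private primes to even powers, and the character at the tame place `(σ)`

research route conditional on HC_CM; not a corollary; Q11.4-sentence-2 already refuted in dim ≥ 3. Cell
`pub-hodge-ring2`, seat `ring2-b03` (gen 53); `HOME/WEIL-FAMILY-COVERAGE.md` §b03.5, seventh table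
(`F = ℚ(√2)`, `R = S² + 6S + 7`). Parts M/N classified the integer rows `W8.E.[n]` of the six Galois fields
(«even exponents at the non-split primes»). The non-Galois field is different: `[3] = [7] ≠ [1]` but
`[21] = [1]` — its rational primes fall into THREE kinds (part V): the SPLIT type `S` (`[ℓ] = [1]`: `ℓ = 2`;
`ℓ ≡ 5 (8)`, `ℓ ≡ 1,2,4 (7)`; `ℓ ≡ 1 (8)`, `ℓ ≡ 1,2,4 (7)`, root of `T⁴ + 6T² + 7`), the THREE type `T`
(`[ℓ] = [3]`, the class `{(√2), (σ)}`: `ℓ = 7`; `ℓ ≡ 3 (8)`, `ℓ ≡ 3,5,6 (7)`; `ℓ ≡ 7 (8)`, `ℓ ≡ 3,5,6 (7)`,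
root), and the PRIVATE primes (all others: parts C, H, O give `[ℓw] ≠ [1]` for `ℓ ∤ w`).

* §1 `private_obstruction` (`[ℓw] ≠ [1]`, parts C/H/O), `threeType_class` (`[3ℓ] = [1]`, part V, `[21] = [1]`);
* §2 **`sqrtNegThreePlusSqrtTwo_natCast_eq_split_iff`**, every `n ≥ 1`: **`[n] = [1] ⟺ (every private prime
  divides n to an even power) ∧ (ordCompl[7] n is a square mod 7 ↔ 7 divides n to an even power)`** — the second
  clause is the character at `(σ)` (it counts the type-`T` primes of `n` mod 2); `[3n] = [1]` iff it fails instead.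

No named fact, no definition, no `sorry`; nothing about the Hodge conjecture is asserted.
References: [Deligne1982HodgeCycles] §4 p. 30 (1), Cor. 4.2; [Landherr1936HermitianForms]. -/

noncomputable section

set_option linter.dupNamespace false

open Polynomial

namespace Summit.HodgeConjecture.HodgeConjecture.Ring2.WeilCoverageCM

open Literature.AlgebraicGeometry.Deligne1982
open Literature.AlgebraicGeometry.HodgeTheory (splitDiscriminantClassCM)

section SqrtNegThreePlusSqrtTwo

variable {R : Polynomial ℤ} (hR : R = X ^ 2 + C 6 * X + C 7) [Fact (Irreducible (realPolyQ R))]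
include hR

/-! ### §1 The three kinds of primes -/

/-- **Private primes obstruct with any cofactor**: for a prime `ℓ` neither of split type nor of three type,
`[ℓw] ≠ [1]` for every `ℓ ∤ w` (part C: inert in `F` and `E/F`; part H: half-split; part O: both places inert).
[cite: Deligne1982HodgeCycles, §4 p. 30 (1) and Cor. 4.2] [cite: Landherr1936HermitianForms] -/
theorem sqrtNegThreePlusSqrtTwo_private_obstruction (ℓ : ℕ) (hℓ : ℓ.Prime)
    (hS : ¬ (ℓ = 2 ∨ (ℓ % 8 = 5 ∧ (ℓ % 7 = 1 ∨ ℓ % 7 = 2 ∨ ℓ % 7 = 4)) ∨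
      (ℓ % 8 = 1 ∧ (ℓ % 7 = 1 ∨ ℓ % 7 = 2 ∨ ℓ % 7 = 4) ∧ ∃ e : ZMod ℓ, e ^ 4 + 6 * e ^ 2 + 7 = 0)))
    (hT : ¬ (ℓ = 7 ∨ (ℓ % 8 = 3 ∧ (ℓ % 7 = 3 ∨ ℓ % 7 = 5 ∨ ℓ % 7 = 6)) ∨
      (ℓ % 8 = 7 ∧ (ℓ % 7 = 3 ∨ ℓ % 7 = 5 ∨ ℓ % 7 = 6) ∧ ∃ e : ZMod ℓ, e ^ 4 + 6 * e ^ 2 + 7 = 0)))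
    (w : ℤ) (hw : ¬ (ℓ : ℤ) ∣ w) (u : (realField R)ˣ)
    (hu : (u : realField R) = AdjoinRoot.of (realPolyQ R) (ℓ * w)) :
    (QuotientGroup.mk u : cmNormResidueGroup R) ≠ splitDiscriminantClassCM R 2 := by
  have hℓ7 : ℓ ≠ 7 := fun h => hT (Or.inl h)
  have hodd : ℓ % 2 = 1 := Nat.odd_iff.1 (hℓ.odd_of_ne_two (fun h => hS (Or.inl h)))
  have h70 : ℓ % 7 ≠ 0 := fun h0 => by
    rcases (Nat.dvd_prime hℓ).1 (Nat.dvd_of_mod_eq_zero h0) with h1 | h1 <;> omega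
  have h8 : ℓ % 8 = 1 ∨ ℓ % 8 = 3 ∨ ℓ % 8 = 5 ∨ ℓ % 8 = 7 := by omega
  have h7 : (ℓ % 7 = 1 ∨ ℓ % 7 = 2 ∨ ℓ % 7 = 4) ∨ (ℓ % 7 = 3 ∨ ℓ % 7 = 5 ∨ ℓ % 7 = 6) := by omega
  rcases h8 with h81 | h83 | h85 | h87
  · rcases h7 with hq | hn
    · -- `ℓ ≡ 1 (8)`, residue: split unless no root
      by_cases hroot : ∃ e : ZMod ℓ, e ^ 4 + 6 * e ^ 2 + 7 = 0
      · exact absurd (Or.inr (Or.inr ⟨h81, hq, hroot⟩)) hS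
      · push Not at hroot
        exact sqrtNegThreePlusSqrtTwo_mk_prime_mul_ne_splitDiscriminantClassCM_of_noRoot hR ℓ hℓ (Or.inl h81)
          hroot w hw u hu
    · exact sqrtNegThreePlusSqrtTwo_mk_prime_mul_ne_splitDiscriminantClassCM_of_halfSplit hR ℓ hℓ (by omega)
        w hw u hu
  · rcases h7 with hq | hn
    · exact sqrtNegThreePlusSqrtTwo_mk_prime_mul_ne_splitDiscriminantClassCM_of_mod_fiftySix hR ℓ hℓ (by omega)
        w hw u hu
    · exact absurd (Or.inr (Or.inl ⟨h83, hn⟩)) hT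
  · rcases h7 with hq | hn
    · exact absurd (Or.inr (Or.inl ⟨h85, hq⟩)) hS
    · exact sqrtNegThreePlusSqrtTwo_mk_prime_mul_ne_splitDiscriminantClassCM_of_mod_fiftySix hR ℓ hℓ (by omega)
        w hw u hu
  · rcases h7 with hq | hn
    · exact sqrtNegThreePlusSqrtTwo_mk_prime_mul_ne_splitDiscriminantClassCM_of_halfSplit hR ℓ hℓ (by omega)
        w hw u hu
    · by_cases hroot : ∃ e : ZMod ℓ, e ^ 4 + 6 * e ^ 2 + 7 = 0
      · exact absurd (Or.inr (Or.inr ⟨h87, hn, hroot⟩)) hT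
      · push Not at hroot
        exact sqrtNegThreePlusSqrtTwo_mk_prime_mul_ne_splitDiscriminantClassCM_of_noRoot hR ℓ hℓ (Or.inr h87)
          hroot w hw u hu

/-- **`[3ℓ] = [1]` for every prime of three type** (`ℓ = 7`: `21 = σ² - σ(5+σ)²`; part V otherwise).
[cite: Deligne1982HodgeCycles, §4 p. 30 (1) and Cor. 4.2] -/
theorem sqrtNegThreePlusSqrtTwo_threeType_class (ℓ : ℕ) (hℓ : ℓ.Prime)
    (hT : ℓ = 7 ∨ (ℓ % 8 = 3 ∧ (ℓ % 7 = 3 ∨ ℓ % 7 = 5 ∨ ℓ % 7 = 6)) ∨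
      (ℓ % 8 = 7 ∧ (ℓ % 7 = 3 ∨ ℓ % 7 = 5 ∨ ℓ % 7 = 6) ∧ ∃ e : ZMod ℓ, e ^ 4 + 6 * e ^ 2 + 7 = 0))
    (u : (realField R)ˣ) (hu : (u : realField R) = 3 * ℓ) :
    (QuotientGroup.mk u : cmNormResidueGroup R) = splitDiscriminantClassCM R 2 := by
  rcases hT with h7 | ⟨h8, hn⟩ | ⟨h8, hn, hroot⟩
  · subst h7
    exact mk_eq_splitDiscriminantClassCM_two_of_coords_of_pos hR (by norm_num) (by norm_num) disc_not_sq_six_seven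
      21 0 1 5 1 1 one_ne_zero (by norm_num) (by norm_num) u (by rw [hu]; norm_num)
  · exact sqrtNegThreePlusSqrtTwo_mk_three_mul_prime_eq_splitDiscriminantClassCM_of_mod_eight_three hR ℓ hℓ h8 hn u hu
  · exact sqrtNegThreePlusSqrtTwo_mk_three_mul_prime_eq_splitDiscriminantClassCM_of_mod_eight_seven hR ℓ hℓ h8 hn
      hroot u hu

omit hR in
/-- The residue of a three-type prime other than `7` is a non-square mod `7`, that of a split-type prime other than
`7` a nonzero square (`2 ≡ 3²`). [folklore] -/
theorem sqrtNegThreePlusSqrtTwo_type_residue (ℓ : ℕ) :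
    ((ℓ = 2 ∨ (ℓ % 8 = 5 ∧ (ℓ % 7 = 1 ∨ ℓ % 7 = 2 ∨ ℓ % 7 = 4)) ∨
      (ℓ % 8 = 1 ∧ (ℓ % 7 = 1 ∨ ℓ % 7 = 2 ∨ ℓ % 7 = 4) ∧ ∃ e : ZMod ℓ, e ^ 4 + 6 * e ^ 2 + 7 = 0)) →
      IsSquare ((ℓ : ZMod 7)) ∧ (ℓ : ZMod 7) ≠ 0) ∧
    ((ℓ % 8 = 3 ∧ (ℓ % 7 = 3 ∨ ℓ % 7 = 5 ∨ ℓ % 7 = 6)) ∨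
      (ℓ % 8 = 7 ∧ (ℓ % 7 = 3 ∨ ℓ % 7 = 5 ∨ ℓ % 7 = 6) ∧ ∃ e : ZMod ℓ, e ^ 4 + 6 * e ^ 2 + 7 = 0) →
      ¬ IsSquare ((ℓ : ZMod 7)) ∧ (ℓ : ZMod 7) ≠ 0) := by
  constructor
  · rintro (h2 | ⟨-, h7⟩ | ⟨-, h7, -⟩)
    · subst h2; decide
    · rw [← ZMod.natCast_mod ℓ 7]; rcases h7 with h | h | h <;> rw [h] <;> decide
    · rw [← ZMod.natCast_mod ℓ 7]; rcases h7 with h | h | h <;> rw [h] <;> decide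
  · rintro (⟨-, h7⟩ | ⟨-, h7, -⟩)
    · rw [← ZMod.natCast_mod ℓ 7]; rcases h7 with h | h | h <;> rw [h] <;> decide
    · rw [← ZMod.natCast_mod ℓ 7]; rcases h7 with h | h | h <;> rw [h] <;> decide

/-! ### §2 The integer classes -/

omit hR in
/-- Squares mod `7`: multiplying by a nonzero square preserves, by a non-square flips, (non-)squareness of a unit.
[folklore] -/
theorem zmod7_isSquare_mul (a m : ZMod 7) (ha : a ≠ 0) (hm : m ≠ 0) :
    (IsSquare a → (IsSquare (a * m) ↔ IsSquare m)) ∧ (¬ IsSquare a → (IsSquare (a * m) ↔ ¬ IsSquare m)) := by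
  revert a m
  decide

/-- **Integer classes with the three-type count.** For `n ≥ 1` whose PRIVATE primes occur to even powers:
`[n] = [1]` if `IsSquare (ordCompl[7] n mod 7) ↔ Even (v₇ n)`, and `[3n] = [1]` if not (peel the least prime: split
primes and private squares keep the condition, a three-type prime flips it and contributes `[3]`).
[cite: Deligne1982HodgeCycles, §4 p. 30 (1) and Cor. 4.2] [cite: Landherr1936HermitianForms] -/
theorem sqrtNegThreePlusSqrtTwo_natCast_class_of_private_even (n : ℕ) : 1 ≤ n →
    (∀ ℓ : ℕ, ℓ.Prime →
      ¬ (ℓ = 2 ∨ (ℓ % 8 = 5 ∧ (ℓ % 7 = 1 ∨ ℓ % 7 = 2 ∨ ℓ % 7 = 4)) ∨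
        (ℓ % 8 = 1 ∧ (ℓ % 7 = 1 ∨ ℓ % 7 = 2 ∨ ℓ % 7 = 4) ∧ ∃ e : ZMod ℓ, e ^ 4 + 6 * e ^ 2 + 7 = 0)) →
      ¬ (ℓ = 7 ∨ (ℓ % 8 = 3 ∧ (ℓ % 7 = 3 ∨ ℓ % 7 = 5 ∨ ℓ % 7 = 6)) ∨
        (ℓ % 8 = 7 ∧ (ℓ % 7 = 3 ∨ ℓ % 7 = 5 ∨ ℓ % 7 = 6) ∧ ∃ e : ZMod ℓ, e ^ 4 + 6 * e ^ 2 + 7 = 0)) →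
      Even (n.factorization ℓ)) →
    ((IsSquare ((n / 7 ^ n.factorization 7 : ℕ) : ZMod 7) ↔ Even (n.factorization 7)) →
      ∀ v : (realField R)ˣ, (v : realField R) = n →
        (QuotientGroup.mk v : cmNormResidueGroup R) = splitDiscriminantClassCM R 2) ∧
    (¬ (IsSquare ((n / 7 ^ n.factorization 7 : ℕ) : ZMod 7) ↔ Even (n.factorization 7)) →
      ∀ v : (realField R)ˣ, (v : realField R) = 3 * n →
        (QuotientGroup.mk v : cmNormResidueGroup R) = splitDiscriminantClassCM R 2) := by
  classical
  haveI : Fact (Irreducible (cmPolyQ R)) := fact_irreducible_cmPolyQ_of_pos hR (by norm_num) (by norm_num) disc_not_sq_six_seven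
  induction n using Nat.strong_induction_on with
  | _ n ih =>
  intro hn heven
  have three_ne : (3 : realField R) ≠ 0 := three_ne_zero
  have keep : ∀ (P P₁ E E₁ : Prop), (P ↔ P₁) → (E ↔ E₁) → ((P ↔ E) ↔ (P₁ ↔ E₁)) := by
    intro P P₁ E E₁ h1 h2; rw [h1, h2]
  have flipP : ∀ (P P₁ E E₁ : Prop), (P ↔ ¬ P₁) → (E ↔ E₁) → ((P ↔ E) ↔ ¬ (P₁ ↔ E₁)) := by
    intro P P₁ E E₁ h1 h2; rw [h1, h2]; tauto
  have flipE : ∀ (P P₁ E E₁ : Prop), (P ↔ P₁) → (E ↔ ¬ E₁) → ((P ↔ E) ↔ ¬ (P₁ ↔ E₁)) := by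
    intro P P₁ E E₁ h1 h2; rw [h1, h2]; tauto
  by_cases hn1 : n = 1
  · subst hn1
    refine ⟨fun _ v hv => natCast_one_eq_split v (by rw [hv]), fun h => absurd ?_ h⟩
    simp only [Nat.factorization_one, Finsupp.coe_zero, Pi.zero_apply, pow_zero, Nat.div_one, Nat.cast_one]
    exact ⟨fun _ => Even.zero, fun _ => ⟨1, by ring⟩⟩
  have hn2 : 2 ≤ n := by omega
  have hn0 : n ≠ 0 := by omega
  set q := n.minFac with hqdef
  have hq : q.Prime := Nat.minFac_prime hn1
  have hq0 : q ≠ 0 := hq.ne_zero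
  obtain ⟨n₁, hn₁⟩ : q ∣ n := Nat.minFac_dvd n
  have hn₁0 : n₁ ≠ 0 := by rintro rfl; rw [mul_zero] at hn₁; exact hn0 hn₁
  have hn₁pos : 1 ≤ n₁ := Nat.one_le_iff_ne_zero.2 hn₁0
  have hn₁lt : n₁ < n := by rw [hn₁]; nlinarith [hq.two_le]
  have hfac : ∀ ℓ : ℕ, n.factorization ℓ = q.factorization ℓ + n₁.factorization ℓ := fun ℓ => by
    rw [hn₁, Nat.factorization_mul hq0 hn₁0, Finsupp.add_apply]
  have hord : (n / 7 ^ n.factorization 7 : ℕ) = (q / 7 ^ q.factorization 7) * (n₁ / 7 ^ n₁.factorization 7) := by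
    rw [hn₁]; exact Nat.ordCompl_mul q n₁ 7
  have hordq7 : q ≠ 7 → (q / 7 ^ q.factorization 7 : ℕ) = q := fun hq7 => by
    rw [Nat.factorization_eq_zero_of_not_dvd (fun h => hq7 ((Nat.prime_dvd_prime_iff_eq (by norm_num) hq).1 h).symm),
      pow_zero, Nat.div_one]
  have hm₁ne : ((n₁ / 7 ^ n₁.factorization 7 : ℕ) : ZMod 7) ≠ 0 := by
    rw [Ne, ZMod.natCast_eq_zero_iff]
    exact Nat.not_dvd_ordCompl (by norm_num) hn₁0
  set uq : (realField R)ˣ := Units.mk0 (q : realField R) (natCast_ne_zero_realField q hq.one_lt.le) with huq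
  set u₁ : (realField R)ˣ := Units.mk0 (n₁ : realField R) (natCast_ne_zero_realField n₁ hn₁pos) with hu₁
  set u3 : (realField R)ˣ := Units.mk0 (3 : realField R) three_ne with hu3
  by_cases hSq : q = 2 ∨ (q % 8 = 5 ∧ (q % 7 = 1 ∨ q % 7 = 2 ∨ q % 7 = 4)) ∨
      (q % 8 = 1 ∧ (q % 7 = 1 ∨ q % 7 = 2 ∨ q % 7 = 4) ∧ ∃ e : ZMod q, e ^ 4 + 6 * e ^ 2 + 7 = 0)
  · -- SPLIT prime: strip it; the character condition is unchanged
    have hq7 : q ≠ 7 := by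
      intro hq7
      rcases hSq with h | ⟨h, -⟩ | ⟨h, -⟩ <;> omega
    have hres := (sqrtNegThreePlusSqrtTwo_type_residue q).1 hSq
    have heven₁ : ∀ ℓ : ℕ, ℓ.Prime → ¬ (ℓ = 2 ∨ (ℓ % 8 = 5 ∧ (ℓ % 7 = 1 ∨ ℓ % 7 = 2 ∨ ℓ % 7 = 4)) ∨
        (ℓ % 8 = 1 ∧ (ℓ % 7 = 1 ∨ ℓ % 7 = 2 ∨ ℓ % 7 = 4) ∧ ∃ e : ZMod ℓ, e ^ 4 + 6 * e ^ 2 + 7 = 0)) →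
      ¬ (ℓ = 7 ∨ (ℓ % 8 = 3 ∧ (ℓ % 7 = 3 ∨ ℓ % 7 = 5 ∨ ℓ % 7 = 6)) ∨
        (ℓ % 8 = 7 ∧ (ℓ % 7 = 3 ∨ ℓ % 7 = 5 ∨ ℓ % 7 = 6) ∧ ∃ e : ZMod ℓ, e ^ 4 + 6 * e ^ 2 + 7 = 0)) → Even (n₁.factorization ℓ) := by
      intro ℓ hℓ hSℓ hTℓ
      have hne : ℓ ≠ q := fun h => hSℓ (h ▸ hSq)
      have h0 : q.factorization ℓ = 0 :=
        Nat.factorization_eq_zero_of_not_dvd ((Nat.prime_dvd_prime_iff_eq hℓ hq).not.2 hne)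
      have h := heven ℓ hℓ hSℓ hTℓ
      rwa [hfac ℓ, h0, zero_add] at h
    obtain ⟨ih₁, ih₂⟩ := ih n₁ hn₁lt hn₁pos heven₁
    have hq1 := (sqrtNegThreePlusSqrtTwo_mk_prime_eq_splitDiscriminantClassCM_iff hR q hq uq (Units.val_mk0 _)).2 hSq
    have hcond : (IsSquare ((n / 7 ^ n.factorization 7 : ℕ) : ZMod 7) ↔ Even (n.factorization 7)) ↔
        (IsSquare ((n₁ / 7 ^ n₁.factorization 7 : ℕ) : ZMod 7) ↔ Even (n₁.factorization 7)) := by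
      have h7f : n.factorization 7 = n₁.factorization 7 := by
        rw [hfac 7, Nat.factorization_eq_zero_of_not_dvd
          (fun h => hq7 ((Nat.prime_dvd_prime_iff_eq (by norm_num) hq).1 h).symm), zero_add]
      have hP : IsSquare ((n / 7 ^ n.factorization 7 : ℕ) : ZMod 7) ↔
          IsSquare ((n₁ / 7 ^ n₁.factorization 7 : ℕ) : ZMod 7) := by
        rw [hord, hordq7 hq7, Nat.cast_mul]
        exact (zmod7_isSquare_mul _ _ hres.2 hm₁ne).1 hres.1
      exact keep _ _ _ _ hP (by rw [h7f])
    constructor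
    · intro hc v hv
      have h1 := ih₁ (hcond.1 hc) u₁ (Units.val_mk0 _)
      have hv' : v = uq * u₁ := Units.ext (by rw [hv, hn₁, Units.val_mul, huq, hu₁, Units.val_mk0, Units.val_mk0]; push_cast; ring)
      rw [hv']
      exact mk_mul_eq_splitDiscriminantClassCM_two _ _ hq1 h1
    · intro hc v hv
      have h1 := ih₂ (fun h => hc (hcond.2 h)) (u3 * u₁) (by rw [Units.val_mul, hu3, hu₁, Units.val_mk0, Units.val_mk0])
      have hv' : v = uq * (u3 * u₁) := Units.ext (by
        rw [hv, hn₁, Units.val_mul, Units.val_mul, huq, hu3, hu₁, Units.val_mk0, Units.val_mk0, Units.val_mk0]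
        push_cast; ring)
      rw [hv']
      exact mk_mul_eq_splitDiscriminantClassCM_two _ _ hq1 h1
  by_cases hTq : q = 7 ∨ (q % 8 = 3 ∧ (q % 7 = 3 ∨ q % 7 = 5 ∨ q % 7 = 6)) ∨
      (q % 8 = 7 ∧ (q % 7 = 3 ∨ q % 7 = 5 ∨ q % 7 = 6) ∧ ∃ e : ZMod q, e ^ 4 + 6 * e ^ 2 + 7 = 0)
  · -- THREE-type prime: strip it with a `[3]`; the character condition flips
    have heven₁ : ∀ ℓ : ℕ, ℓ.Prime → ¬ (ℓ = 2 ∨ (ℓ % 8 = 5 ∧ (ℓ % 7 = 1 ∨ ℓ % 7 = 2 ∨ ℓ % 7 = 4)) ∨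
        (ℓ % 8 = 1 ∧ (ℓ % 7 = 1 ∨ ℓ % 7 = 2 ∨ ℓ % 7 = 4) ∧ ∃ e : ZMod ℓ, e ^ 4 + 6 * e ^ 2 + 7 = 0)) →
      ¬ (ℓ = 7 ∨ (ℓ % 8 = 3 ∧ (ℓ % 7 = 3 ∨ ℓ % 7 = 5 ∨ ℓ % 7 = 6)) ∨
        (ℓ % 8 = 7 ∧ (ℓ % 7 = 3 ∨ ℓ % 7 = 5 ∨ ℓ % 7 = 6) ∧ ∃ e : ZMod ℓ, e ^ 4 + 6 * e ^ 2 + 7 = 0)) → Even (n₁.factorization ℓ) := by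
      intro ℓ hℓ hSℓ hTℓ
      have hne : ℓ ≠ q := fun h => hTℓ (h ▸ hTq)
      have h0 : q.factorization ℓ = 0 :=
        Nat.factorization_eq_zero_of_not_dvd ((Nat.prime_dvd_prime_iff_eq hℓ hq).not.2 hne)
      have h := heven ℓ hℓ hSℓ hTℓ
      rwa [hfac ℓ, h0, zero_add] at h
    obtain ⟨ih₁, ih₂⟩ := ih n₁ hn₁lt hn₁pos heven₁
    have hq3 := sqrtNegThreePlusSqrtTwo_threeType_class hR q hq hTq (u3 * uq)
      (by rw [Units.val_mul, hu3, huq, Units.val_mk0, Units.val_mk0])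
    have hcond : (IsSquare ((n / 7 ^ n.factorization 7 : ℕ) : ZMod 7) ↔ Even (n.factorization 7)) ↔
        ¬ (IsSquare ((n₁ / 7 ^ n₁.factorization 7 : ℕ) : ZMod 7) ↔ Even (n₁.factorization 7)) := by
      rcases hTq with hq7 | hT'
      · -- `q = 7`
        have h7f : n.factorization 7 = n₁.factorization 7 + 1 := by
          rw [hfac 7, hq7, Nat.Prime.factorization_self (by norm_num)]; ring
        have hord7 : (n / 7 ^ n.factorization 7 : ℕ) = (n₁ / 7 ^ n₁.factorization 7 : ℕ) := by
          have hq71 : (q / 7 ^ q.factorization 7 : ℕ) = 1 := by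
            rw [hq7, Nat.Prime.factorization_self (by norm_num), pow_one]
          rw [hord, hq71, one_mul]
        exact flipE _ _ _ _ (by rw [hord7]) (by rw [h7f, Nat.even_add_one])
      · have hq7 : q ≠ 7 := by
          intro hq7
          rcases hT' with ⟨h, h'⟩ | ⟨h, h', -⟩ <;> omega
        have hres := (sqrtNegThreePlusSqrtTwo_type_residue q).2 hT'
        have h7f : n.factorization 7 = n₁.factorization 7 := by
          rw [hfac 7, Nat.factorization_eq_zero_of_not_dvd
            (fun h => hq7 ((Nat.prime_dvd_prime_iff_eq (by norm_num) hq).1 h).symm), zero_add]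
        have hP : IsSquare ((n / 7 ^ n.factorization 7 : ℕ) : ZMod 7) ↔
            ¬ IsSquare ((n₁ / 7 ^ n₁.factorization 7 : ℕ) : ZMod 7) := by
          rw [hord, hordq7 hq7, Nat.cast_mul]
          exact (zmod7_isSquare_mul _ _ hres.2 hm₁ne).2 hres.1
        exact flipP _ _ _ _ hP (by rw [h7f])
    constructor
    · intro hc v hv
      have h1 := ih₂ (hcond.1 hc) (u3 * u₁) (by rw [Units.val_mul, hu3, hu₁, Units.val_mk0, Units.val_mk0])
      have hprod := mk_mul_eq_splitDiscriminantClassCM_two _ _ hq3 h1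
      have hv' : (u3 * uq) * (u3 * u₁) = v * u3 ^ 2 := Units.ext (by
        rw [Units.val_mul, Units.val_mul, Units.val_mul, Units.val_mul, Units.val_pow_eq_pow_val, huq, hu3, hu₁,
          Units.val_mk0, Units.val_mk0, Units.val_mk0, hv, hn₁]
        push_cast; ring)
      rwa [hv', mk_mul_sq_cmNormResidueGroup] at hprod
    · intro hc v hv
      have h1 := ih₁ (by_contra fun h => hc (hcond.2 h)) u₁ (Units.val_mk0 _)
      have hv' : v = (u3 * uq) * u₁ := Units.ext (by
        rw [hv, hn₁, Units.val_mul, Units.val_mul, huq, hu3, hu₁, Units.val_mk0, Units.val_mk0, Units.val_mk0]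
        push_cast; ring)
      rw [hv']
      exact mk_mul_eq_splitDiscriminantClassCM_two _ _ hq3 h1
  · -- PRIVATE prime: it occurs squared; strip `q²`, the condition is unchanged
    have hq7 : q ≠ 7 := fun h => hTq (Or.inl h)
    have hq1 : q.factorization q = 1 := hq.factorization_self
    have h2 : 2 ≤ n.factorization q := by
      obtain ⟨j, hj⟩ := heven q hq hSq hTq
      have h1 : 1 ≤ n.factorization q := by rw [hfac q, hq1]; omega
      omega
    obtain ⟨n₂, hn₂⟩ : q ^ 2 ∣ n := (hq.pow_dvd_iff_le_factorization hn0).2 h2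
    have hn₂0 : n₂ ≠ 0 := by rintro rfl; rw [mul_zero] at hn₂; exact hn0 hn₂
    have hn₂pos : 1 ≤ n₂ := Nat.one_le_iff_ne_zero.2 hn₂0
    have hn₂lt : n₂ < n := by rw [hn₂]; nlinarith [hq.two_le]
    have hfac₂ : ∀ ℓ : ℕ, n.factorization ℓ = 2 * q.factorization ℓ + n₂.factorization ℓ := fun ℓ => by
      rw [hn₂, Nat.factorization_mul (pow_ne_zero 2 hq0) hn₂0, Finsupp.add_apply, Nat.factorization_pow,
        Finsupp.smul_apply, smul_eq_mul]
    have heven₂ : ∀ ℓ : ℕ, ℓ.Prime → ¬ (ℓ = 2 ∨ (ℓ % 8 = 5 ∧ (ℓ % 7 = 1 ∨ ℓ % 7 = 2 ∨ ℓ % 7 = 4)) ∨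
        (ℓ % 8 = 1 ∧ (ℓ % 7 = 1 ∨ ℓ % 7 = 2 ∨ ℓ % 7 = 4) ∧ ∃ e : ZMod ℓ, e ^ 4 + 6 * e ^ 2 + 7 = 0)) →
      ¬ (ℓ = 7 ∨ (ℓ % 8 = 3 ∧ (ℓ % 7 = 3 ∨ ℓ % 7 = 5 ∨ ℓ % 7 = 6)) ∨
        (ℓ % 8 = 7 ∧ (ℓ % 7 = 3 ∨ ℓ % 7 = 5 ∨ ℓ % 7 = 6) ∧ ∃ e : ZMod ℓ, e ^ 4 + 6 * e ^ 2 + 7 = 0)) → Even (n₂.factorization ℓ) := by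
      intro ℓ hℓ hSℓ hTℓ
      have h := heven ℓ hℓ hSℓ hTℓ
      rw [hfac₂ ℓ] at h
      exact (Nat.even_add.1 h).1 (even_two_mul _)
    obtain ⟨ih₁, ih₂⟩ := ih n₂ hn₂lt hn₂pos heven₂
    have hm₂ne : ((n₂ / 7 ^ n₂.factorization 7 : ℕ) : ZMod 7) ≠ 0 := by
      rw [Ne, ZMod.natCast_eq_zero_iff]
      exact Nat.not_dvd_ordCompl (by norm_num) hn₂0
    have hqres : ((q : ZMod 7)) ≠ 0 := by
      rw [Ne, ZMod.natCast_eq_zero_iff]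
      exact fun h => hq7 ((Nat.prime_dvd_prime_iff_eq (by norm_num) hq).1 h).symm
    have hcond : (IsSquare ((n / 7 ^ n.factorization 7 : ℕ) : ZMod 7) ↔ Even (n.factorization 7)) ↔
        (IsSquare ((n₂ / 7 ^ n₂.factorization 7 : ℕ) : ZMod 7) ↔ Even (n₂.factorization 7)) := by
      have h7f : n.factorization 7 = n₂.factorization 7 := by
        rw [hfac₂ 7, Nat.factorization_eq_zero_of_not_dvd
          (fun h => hq7 ((Nat.prime_dvd_prime_iff_eq (by norm_num) hq).1 h).symm), mul_zero, zero_add]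
      have hord₂ : (n / 7 ^ n.factorization 7 : ℕ) = q * q * (n₂ / 7 ^ n₂.factorization 7) := by
        rw [hn₂, Nat.ordCompl_mul, sq, Nat.ordCompl_mul, hordq7 hq7]
      have hsq : IsSquare ((q : ZMod 7) * q) := ⟨q, rfl⟩
      have hP : IsSquare ((n / 7 ^ n.factorization 7 : ℕ) : ZMod 7) ↔
          IsSquare ((n₂ / 7 ^ n₂.factorization 7 : ℕ) : ZMod 7) := by
        haveI : Fact (Nat.Prime 7) := ⟨by norm_num⟩
        rw [hord₂, Nat.cast_mul, Nat.cast_mul]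
        exact (zmod7_isSquare_mul _ _ (mul_ne_zero hqres hqres) hm₂ne).1 hsq
      exact keep _ _ _ _ hP (by rw [h7f])
    constructor
    · intro hc v hv
      exact natCast_sq_mul_eq_split q n₂ hq.one_lt.le (ih₁ (hcond.1 hc)) v (by rw [hv, hn₂]; ring_nf)
    · intro hc v hv
      have h1 := ih₂ (fun h => hc (hcond.2 h))
      have hn₂F : ((3 * n₂ : ℕ) : realField R) ≠ 0 := natCast_ne_zero_realField _ (by omega)
      refine natCast_sq_mul_eq_split q (3 * n₂) hq.one_lt.le (fun w hw => h1 w (by rw [hw]; push_cast; ring)) v ?_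
      rw [hv, hn₂]; push_cast; ring

/-- **The integer classes of the seventh census table (`E = ℚ(√-(3+√2))`), every `n ≥ 1`: `[n] = [1]` iff
every PRIVATE prime divides `n` to an even power and `ordCompl[7] n` is a square mod `7` exactly when `7` divides
`n` to an even power** (⟹: an odd private exponent gives `[ℓ·w₀] = [1]` against §1; the character clause since
otherwise `[3n] = [1]`, `[3] ≠ [1]`). [cite: Deligne1982HodgeCycles, §4 p. 30 (1) and Cor. 4.2]
[cite: Landherr1936HermitianForms] -/
theorem sqrtNegThreePlusSqrtTwo_natCast_eq_split_iff (n : ℕ) (hn : 1 ≤ n) (v : (realField R)ˣ)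
    (hv : (v : realField R) = n) :
    (QuotientGroup.mk v : cmNormResidueGroup R) = splitDiscriminantClassCM R 2 ↔
      (∀ ℓ : ℕ, ℓ.Prime →
        ¬ (ℓ = 2 ∨ (ℓ % 8 = 5 ∧ (ℓ % 7 = 1 ∨ ℓ % 7 = 2 ∨ ℓ % 7 = 4)) ∨
          (ℓ % 8 = 1 ∧ (ℓ % 7 = 1 ∨ ℓ % 7 = 2 ∨ ℓ % 7 = 4) ∧ ∃ e : ZMod ℓ, e ^ 4 + 6 * e ^ 2 + 7 = 0)) →
        ¬ (ℓ = 7 ∨ (ℓ % 8 = 3 ∧ (ℓ % 7 = 3 ∨ ℓ % 7 = 5 ∨ ℓ % 7 = 6)) ∨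
          (ℓ % 8 = 7 ∧ (ℓ % 7 = 3 ∨ ℓ % 7 = 5 ∨ ℓ % 7 = 6) ∧ ∃ e : ZMod ℓ, e ^ 4 + 6 * e ^ 2 + 7 = 0)) →
        Even (n.factorization ℓ)) ∧
      (IsSquare ((n / 7 ^ n.factorization 7 : ℕ) : ZMod 7) ↔ Even (n.factorization 7)) := by
  classical
  haveI : Fact (Irreducible (cmPolyQ R)) := fact_irreducible_cmPolyQ_of_pos hR (by norm_num) (by norm_num) disc_not_sq_six_seven
  have hn0 : n ≠ 0 := by omega
  constructor
  · intro hsplit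
    have hsplit' : ∀ w : (realField R)ˣ, (w : realField R) = n →
        (QuotientGroup.mk w : cmNormResidueGroup R) = splitDiscriminantClassCM R 2 := fun w hw => by
      rwa [show w = v from Units.ext (hw.trans hv.symm)]
    have hpriv : ∀ ℓ : ℕ, ℓ.Prime → ¬ (ℓ = 2 ∨ (ℓ % 8 = 5 ∧ (ℓ % 7 = 1 ∨ ℓ % 7 = 2 ∨ ℓ % 7 = 4)) ∨
        (ℓ % 8 = 1 ∧ (ℓ % 7 = 1 ∨ ℓ % 7 = 2 ∨ ℓ % 7 = 4) ∧ ∃ e : ZMod ℓ, e ^ 4 + 6 * e ^ 2 + 7 = 0)) →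
      ¬ (ℓ = 7 ∨ (ℓ % 8 = 3 ∧ (ℓ % 7 = 3 ∨ ℓ % 7 = 5 ∨ ℓ % 7 = 6)) ∨
        (ℓ % 8 = 7 ∧ (ℓ % 7 = 3 ∨ ℓ % 7 = 5 ∨ ℓ % 7 = 6) ∧ ∃ e : ZMod ℓ, e ^ 4 + 6 * e ^ 2 + 7 = 0)) → Even (n.factorization ℓ) := by
      intro ℓ hℓ hSℓ hTℓ
      by_contra hodd
      obtain ⟨j, hj⟩ := Nat.not_even_iff_odd.1 hodd
      obtain ⟨w₀, hw₀def⟩ : ∃ w₀ : ℕ, w₀ = n / ℓ ^ n.factorization ℓ := ⟨_, rfl⟩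
      have hw₀ : ℓ ^ n.factorization ℓ * w₀ = n := by rw [hw₀def]; exact Nat.ordProj_mul_ordCompl_eq_self n ℓ
      have hndvd : ¬ ℓ ∣ w₀ := by rw [hw₀def]; exact Nat.not_dvd_ordCompl hℓ hn0
      have hw₀pos : 1 ≤ w₀ := by rw [hw₀def]; exact Nat.ordCompl_pos ℓ hn0
      rw [hj] at hw₀
      have hpos : 1 ≤ ℓ * w₀ := Nat.mul_le_mul hℓ.one_lt.le hw₀pos
      set u : (realField R)ˣ := Units.mk0 (((ℓ * w₀ : ℕ)) : realField R) (natCast_ne_zero_realField _ hpos) with hu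
      have h1 := natCast_prime_mul_eq_split_of_odd n ℓ w₀ j hw₀ hℓ.one_lt.le hsplit' u (Units.val_mk0 _)
      exact sqrtNegThreePlusSqrtTwo_private_obstruction hR ℓ hℓ hSℓ hTℓ (w₀ : ℤ) (fun h => hndvd (by exact_mod_cast h)) u
        (by rw [hu, Units.val_mk0]; push_cast; simp only [map_mul, map_natCast]) h1
    refine ⟨hpriv, ?_⟩
    by_contra hc
    have h3n := (sqrtNegThreePlusSqrtTwo_natCast_class_of_private_even hR n hn hpriv).2 hc
    have hnF : (n : realField R) ≠ 0 := natCast_ne_zero_realField n hn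
    set u3 : (realField R)ˣ := Units.mk0 (3 : realField R) three_ne_zero with hu3
    have h1 := h3n (u3 * v) (by rw [Units.val_mul, hu3, Units.val_mk0, hv])
    have h3 : (QuotientGroup.mk u3 : cmNormResidueGroup R) = splitDiscriminantClassCM R 2 := by
      rw [splitDiscriminantClassCM_two_eq_one] at h1 hsplit ⊢
      calc (QuotientGroup.mk u3 : cmNormResidueGroup R)
          = QuotientGroup.mk ((u3 * v) * v⁻¹) := by rw [mul_inv_cancel_right]
        _ = QuotientGroup.mk (u3 * v) * (QuotientGroup.mk v)⁻¹ := by rw [QuotientGroup.mk_mul, QuotientGroup.mk_inv]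
        _ = 1 := by rw [h1, hsplit, mul_inv_cancel]
    exact sqrtNegThreePlusSqrtTwo_mk_ne_splitDiscriminantClassCM_of_residue hR 3 (Or.inl (by decide)) u3
      (by rw [hu3, Units.val_mk0]; norm_num) h3
  · rintro ⟨hpriv, hc⟩
    exact (sqrtNegThreePlusSqrtTwo_natCast_class_of_private_even hR n hn hpriv).1 hc v hv

end SqrtNegThreePlusSqrtTwo

end Summit.HodgeConjecture.HodgeConjecture.Ring2.WeilCoverageCM

end
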